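import Literature.MathematicalPhysics.KineticTheory.StochasticCollisionHardSphereProcess
import HarnessLib

/-!
# Rejection sampling from an i.i.d. dice sequence: the law of the first success

Helper file of the stub `stub_kickMatchedStationaryCore` (W2) of the crux line `stein-lindeberg-kick-swap`
(crux `InformationPercolationEngine.PercolationClosesChaos`, stmt-AtomisticToContinuum-13914), also needed by S3a
(`SwapIdentity`): the rejection sampler `kmNormal` of the kick-matched gas `Z*` scans an i.i.d. sequence
`d ~ μ^{⊗ℕ}` (`KernelGas.dice μ = Measure.infinitePi (fun _ => μ)`) and takes the first `d n` in an acceptance set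
`A` (`Nat.find`), with a junk value on the event of no success. This file PROVES the textbook facts:

* `KernelGas.dice_forall_notMem_eq_zero` — if `μ A ≠ 0`, the event "no `d n` lies in `A`" is `μ^{⊗ℕ}`-null
  (`(1 − μ A)ⁿ → 0`);
* `KernelGas.map_dice_firstHit` — **the law of the first success is the conditional law**:
  `μ^{⊗ℕ} ∘ (d ↦ d_{first n with d n ∈ A})⁻¹ = μ(A)⁻¹ · μ|_A` (cylinder sets of `Measure.infinitePi`,
  `Measure.infinitePi_pi`, and the geometric series `∑ₙ (1 − μA)ⁿ μ(A ∩ B) = μ(A ∩ B) / μ(A)`).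

Reference: L. Devroye, *Non-Uniform Random Variate Generation*, Springer (1986), §II.3, Thm. 3.1 (the rejection
method returns a variate with the conditional/target law; the number of trials is geometric). Tagged `[folklore]`.
-/

noncomputable section

open scoped BigOperators ENNReal Topology
open MeasureTheory Set Filter

namespace Literature.MathematicalPhysics.KineticTheory

namespace KernelGas

variable {U : Type*} [MeasurableSpace U] (μ : Measure U) [IsProbabilityMeasure μ]

/-- **No success is a null event**: if `μ A ≠ 0` then `μ^{⊗ℕ}`-almost every sequence visits `A`
(`P(d₀, …, d_{n−1} ∉ A) = (1 − μA)ⁿ → 0`). [folklore] -/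
theorem dice_forall_notMem_eq_zero {A : Set U} (hA : MeasurableSet A) (hA0 : μ A ≠ 0) :
    dice μ {d : ℕ → U | ∀ n, d n ∉ A} = 0 := by
  have hle : ∀ n : ℕ, dice μ {d : ℕ → U | ∀ n, d n ∉ A} ≤ μ Aᶜ ^ n := fun n => by
    calc dice μ {d : ℕ → U | ∀ n, d n ∉ A}
        ≤ dice μ (Set.pi (↑(Finset.range n)) fun _ => Aᶜ) := measure_mono fun d hd m _ => hd m
      _ = μ Aᶜ ^ n := by
          rw [dice, Measure.infinitePi_pi (fun _ : ℕ => μ) (fun _ _ => hA.compl), Finset.prod_const, Finset.card_range]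
  have hlt : μ Aᶜ < 1 := by
    rw [prob_compl_eq_one_sub hA]
    exact ENNReal.sub_lt_self ENNReal.one_ne_top one_ne_zero hA0
  have ht : Tendsto (fun n : ℕ => μ Aᶜ ^ n) atTop (𝓝 0) := ENNReal.tendsto_pow_atTop_nhds_zero_of_lt_one hlt
  exact le_antisymm (ge_of_tendsto' ht hle) bot_le

/-- **Rejection sampling: the law of the first success is the conditional law.** For a probability measure `μ`,
a measurable `A` with `μ A ≠ 0`, an arbitrary junk value `x₀` and arbitrary decidability instances (as in a
`Classical` definition by `Nat.find`), the push-forward of `μ^{⊗ℕ}` under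
`d ↦ if h : ∃ n, d n ∈ A then d (Nat.find h) else x₀` is `μ(A)⁻¹ • μ|_A`. [folklore] -/
theorem map_dice_firstHit {A : Set U} (hA : MeasurableSet A) (hA0 : μ A ≠ 0) (x₀ : U)
    {instP : ∀ d : ℕ → U, DecidablePred fun n => d n ∈ A} {instE : ∀ d : ℕ → U, Decidable (∃ n, d n ∈ A)} :
    (dice μ).map (fun d : ℕ → U => if h : ∃ n, d n ∈ A then d (Nat.find h) else x₀) = (μ A)⁻¹ • μ.restrict A := by
  set sel : (ℕ → U) → U := fun d => if h : ∃ n, d n ∈ A then d (Nat.find h) else x₀ with hsel_def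
  -- measurability of the selector
  have hpre : ∀ {B : Set U}, MeasurableSet B → MeasurableSet (sel ⁻¹' B) := by
    intro B hB
    have hrepr : sel ⁻¹' B = (⋃ n, {d : ℕ → U | (∀ m < n, d m ∉ A) ∧ d n ∈ A ∩ B}) ∪
        ({d : ℕ → U | ∀ n, d n ∉ A} ∩ {_d | x₀ ∈ B}) := by
      ext d
      simp only [mem_preimage, mem_union, mem_iUnion, mem_setOf_eq, mem_inter_iff]
      by_cases hex : ∃ n, d n ∈ A
      · have hfs := Nat.find_spec hex
        have hmin : ∀ m < Nat.find hex, d m ∉ A := fun m hm => Nat.find_min hex hm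
        constructor
        · intro h
          rw [hsel_def] at h
          simp only [dif_pos hex] at h
          exact Or.inl ⟨Nat.find hex, hmin, hfs, h⟩
        · rintro (⟨n, hlt, hnA, hnB⟩ | ⟨hno, -⟩)
          · have hfind : Nat.find hex = n := (Nat.find_eq_iff hex).2 ⟨hnA, hlt⟩
            show sel d ∈ B
            rw [hsel_def]
            simp only [dif_pos hex, hfind]
            exact hnB
          · exact absurd hex (not_exists.2 hno)
      · have hno : ∀ n, d n ∉ A := not_exists.1 hex
        constructor
        · intro h
          rw [hsel_def] at h
          simp only [dif_neg hex] at h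
          exact Or.inr ⟨hno, h⟩
        · rintro (⟨n, -, hnA, -⟩ | ⟨-, hx⟩)
          · exact absurd hnA (hno n)
          · show sel d ∈ B
            rw [hsel_def]
            simp only [dif_neg hex]
            exact hx
    rw [hrepr]
    refine (MeasurableSet.iUnion fun n => ?_).union ?_
    · have : {d : ℕ → U | (∀ m < n, d m ∉ A) ∧ d n ∈ A ∩ B} =
          (⋂ m ∈ Finset.range n, (fun d : ℕ → U => d m) ⁻¹' Aᶜ) ∩ (fun d : ℕ → U => d n) ⁻¹' (A ∩ B) := by
        ext d; simp
      rw [this]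
      exact ((Finset.range n).measurableSet_biInter fun m _ => measurable_pi_apply m hA.compl).inter
        (measurable_pi_apply n (hA.inter hB))
    · refine MeasurableSet.inter ?_ ?_
      · have : {d : ℕ → U | ∀ n, d n ∉ A} = ⋂ n, (fun d : ℕ → U => d n) ⁻¹' Aᶜ := by ext d; simp
        rw [this]
        exact MeasurableSet.iInter fun n => measurable_pi_apply n hA.compl
      · exact MeasurableSet.const _
  have hsel : Measurable sel := fun B hB => hpre hB
  -- the first-success events
  set F : ℕ → Set (ℕ → U) := fun n => {d | (∀ m < n, d m ∉ A) ∧ d n ∈ A} with hF_def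
  have hFm : ∀ n, MeasurableSet (F n) := fun n => by
    have : F n = (⋂ m ∈ Finset.range n, (fun d : ℕ → U => d m) ⁻¹' Aᶜ) ∩ (fun d : ℕ → U => d n) ⁻¹' A := by
      ext d; simp [hF_def]
    rw [this]
    exact ((Finset.range n).measurableSet_biInter fun m _ => measurable_pi_apply m hA.compl).inter
      (measurable_pi_apply n hA)
  have hcover : dice μ (⋃ n, F n)ᶜ = 0 := by
    refine measure_mono_null (fun d hd => ?_) (dice_forall_notMem_eq_zero μ hA hA0)
    intro n hn
    have hex : ∃ n, d n ∈ A := ⟨n, hn⟩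
    exact hd (mem_iUnion.2 ⟨Nat.find hex, fun m hm => Nat.find_min hex hm, Nat.find_spec hex⟩)
  ext B hB
  rw [Measure.map_apply hsel hB, Measure.smul_apply, Measure.restrict_apply hB, smul_eq_mul]
  -- decompose along the first-success events
  have h1 : dice μ (sel ⁻¹' B) = ∑' n, dice μ (sel ⁻¹' B ∩ F n) := by
    have hE : dice μ (sel ⁻¹' B) = dice μ (sel ⁻¹' B ∩ ⋃ n, F n) := by
      refine le_antisymm ?_ (measure_mono inter_subset_left)
      calc dice μ (sel ⁻¹' B) ≤ dice μ ((sel ⁻¹' B ∩ ⋃ n, F n) ∪ (⋃ n, F n)ᶜ) :=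
            measure_mono fun d hd => by
              by_cases h : d ∈ ⋃ n, F n
              exacts [Or.inl ⟨hd, h⟩, Or.inr h]
        _ ≤ dice μ (sel ⁻¹' B ∩ ⋃ n, F n) + dice μ (⋃ n, F n)ᶜ := measure_union_le _ _
        _ = dice μ (sel ⁻¹' B ∩ ⋃ n, F n) := by rw [hcover, add_zero]
    rw [hE, inter_iUnion, measure_iUnion]
    · intro m n hmn
      refine Set.disjoint_left.2 fun d hm hn => ?_
      rcases lt_or_gt_of_ne hmn with h | h
      exacts [hn.2.1 m h hm.2.2, hm.2.1 n h hn.2.2]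
    · exact fun n => (hpre hB).inter (hFm n)
  -- each term is a cylinder set
  have h2 : ∀ n, sel ⁻¹' B ∩ F n = Set.pi (↑(Finset.range (n + 1))) (fun m => if m = n then A ∩ B else Aᶜ) := by
    intro n
    ext d
    simp only [mem_inter_iff, mem_preimage, Set.mem_pi, Finset.coe_range, mem_Iio, hF_def, mem_setOf_eq]
    constructor
    · rintro ⟨hBd, hlt, hn⟩ m hm
      rcases Nat.lt_succ_iff_lt_or_eq.1 hm with hm | rfl
      · rw [if_neg hm.ne]
        exact hlt m hm
      · rw [if_pos rfl]
        have hex : ∃ k, d k ∈ A := ⟨m, hn⟩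
        have hfind : Nat.find hex = m := (Nat.find_eq_iff hex).2 ⟨hn, hlt⟩
        refine ⟨hn, ?_⟩
        rw [hsel_def] at hBd
        simp only [dif_pos hex, hfind] at hBd
        exact hBd
    · intro h
      have hn : d n ∈ A ∩ B := by simpa using h n (Nat.lt_succ_self n)
      have hlt : ∀ m < n, d m ∉ A := fun m hm => by
        have := h m (Nat.lt_succ_of_lt hm)
        rw [if_neg hm.ne] at this
        exact this
      have hex : ∃ k, d k ∈ A := ⟨n, hn.1⟩
      have hfind : Nat.find hex = n := (Nat.find_eq_iff hex).2 ⟨hn.1, hlt⟩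
      refine ⟨?_, hlt, hn.1⟩
      show sel d ∈ B
      rw [hsel_def]
      simp only [dif_pos hex, hfind]
      exact hn.2
  have h3 : ∀ n, dice μ (sel ⁻¹' B ∩ F n) = μ Aᶜ ^ n * μ (A ∩ B) := by
    intro n
    have hmeas : ∀ m ∈ Finset.range (n + 1), MeasurableSet (if m = n then A ∩ B else Aᶜ) := fun m _ => by
      split_ifs
      exacts [hA.inter hB, hA.compl]
    rw [h2, dice, Measure.infinitePi_pi (fun _ : ℕ => μ) hmeas, Finset.prod_range_succ, if_pos rfl]
    congr 1
    rw [Finset.prod_congr rfl fun m hm => by rw [if_neg (Finset.mem_range.1 hm).ne], Finset.prod_const,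
      Finset.card_range]
  rw [h1]
  simp_rw [h3]
  rw [ENNReal.tsum_mul_right, ENNReal.tsum_geometric, prob_compl_eq_one_sub hA,
    ENNReal.sub_sub_cancel ENNReal.one_ne_top prob_le_one, inter_comm A B]

end KernelGas

end Literature.MathematicalPhysics.KineticTheory

end
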